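import Literature.LinearAlgebra.Matrix.UnitaryCentralizerSingularLocus
import Literature.NumberTheory.Rogawski1990.RegularOrbitalIntegralLocallyConstantCM
import Literature.NumberTheory.Automorphic.CMTorusRegularAEPrelims
import HarnessLib

/-!
# Haar-almost every element of a Cartan subgroup `Z(γ)` of `U(J)(F_v)` is regular — every regular `γ`, every NON-SPLIT place
# (Harish-Chandra 1970, Lemma 42; Rogawski 1990, §3.6, §12.5 p. 184)

Topic `NumberTheory/Automorphic`; namespace `Literature.NumberTheory.Automorphic.UnitaryGroup`.  THEOREMS ONLY (no definition, no instance, no notation, no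
named fact, no `sorry`).  Cell `pub/hodgecm-mathlib`, crux H413 = `stmt-HodgeConjecture-24833`, line LH6 «StCharTS», datum road S9b′ «CARTAN-NULL» (dealer
LH6-p01 (g4), hand F0P3-p04 (g17)): the in-house DISCHARGE of the per-torus input «the singular set of an elliptic Cartan subgroup is `dγ`-null» of the socket
(C2) `EllCartanAE` of (S-𝔇) (★ `Ch12Sec5Inputs`), for EVERY Cartan subgroup `T = Z(γ)` (`γ` regular semisimple) of `U(J)(F_v)` at a non-split place — the
split torus `M` being ★ `CMTorusRegularAEPairwise`.

SETTING.  `E ∕ F` a quadratic extension of number fields with non-trivial `F`-automorphism `c`, `J ∈ M_N(E)` invertible, `v` a finite place of `F` with a place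
`w ∣ v` of `E` fixed by `c` (non-split), `G = U(J)(F_v) = «local» E c N J v ≤ GL_N(∏_{w′ ∣ v} E_{w′})`, `γ ∈ G` regular (★ `IsRegularElt`), `T = Z_G(γ)`.
* §1 `exists_skew_ne_zero_adicCompletion` (`δ ≠ 0` with `σ_w δ = −δ`), `exists_null_seq_fixed_adicCompletion` (`ε_k = ϖ^k → 0`, `ε_k ≠ 0`, `σ_w ε_k = ε_k`) — the
  scalar inputs of ★ `exists_finset_subgroup_cover_singular_centralizer` at `K = E_w`.
* §2 **`exists_finset_subgroup_cover_singular_centralizer_local`** — the singular locus `{t ∈ T | ¬ IsRegularElt t}` lies in finitely many CLOSED, NON-OPEN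
  subgroups of `T` (★ generic root-kernel theorem in `U(σ_w, J_w)(E_w)` transported along the one-place model ★ `localNonsplitEquiv` restricted to the
  centralisers, ★ `ContinuousMulEquiv.restrictSubgroup`; regularity ★ `isRegularElt_iff_charpoly_separable_localNonsplitEquiv`).
* §3 **`ae_isRegularElt_centralizer_local`** — for EVERY Haar measure `μ_T` on `T`, `μ_T`-almost every `t ∈ T` is regular (Steinhaus ★
  `measure_subgroup_eq_zero_of_not_mem_nhds`: a closed non-open subgroup of the second-countable locally compact `T` is null).
HONEST LABEL.  HC_CM is proved only modulo the printed citations (2 remaining named inputs hLiu418 = `stmt-HodgeConjecture-24832`, h413 =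
`stmt-HodgeConjecture-24833`) until rung 0 closes; this file pays no letter by itself (it discharges the `hnull` input of ★ `F0P3cStCharTSCartanFields` ∕ the `hker`
input of ★ `F0P3cStCharTSCartanNull` at the future concrete datum).

## References
* [HarishChandra1970] Harish-Chandra (notes by G. van Dijk), *Harmonic Analysis on Reductive p-adic Groups*, LNM 162 (1970), Lemma 42 (the singular set of a Cartan
  subgroup is null).
* [Rogawski1990] J. D. Rogawski, *Automorphic Representations of Unitary Groups in Three Variables*, Ann. of Math. Stud. 123 (1990), §3.6 pp. 28–31, §12.5 p. 184.
* [Folland1995] G. B. Folland, *A Course in Abstract Harmonic Analysis* (1995), Prop. 2.4 (Steinhaus).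
* [PlatonovRapinchuk1994] V. Platonov, A. Rapinchuk, *Algebraic Groups and Number Theory* (1994), §5.1, §6.4.
-/

set_option autoImplicit false

noncomputable section

open NumberField IsDedekindDomain MeasureTheory MeasureTheory.Measure Topology Filter
open scoped MatrixGroups

namespace Literature.NumberTheory.Automorphic.UnitaryGroup

open Literature.NumberTheory.Rogawski1990 (IsRegularElt isRegularElt_iff)
open Literature.NumberTheory.GaloisRepresentations Literature.LinearAlgebra.Matrix

section Generic

/-- **Transport of a finite closed non-open subgroup cover along an isomorphism of topological groups restricted to matching subgroups** (★
`ContinuousMulEquiv.restrictSubgroup`): if the failure set of `P'` on `S'` is covered by finitely many closed non-open subgroups and `P' (e a)` implies `P a`,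
then the failure set of `P` on `S` is so covered (pull the subgroups back; a homeomorphism preserves «closed» and «not open»). [cite: HarishChandra1970, Lemma 42] -/
theorem exists_finset_subgroup_cover_of_continuousMulEquiv {A B : Type*} [Group A] [Group B] [TopologicalSpace A] [TopologicalSpace B]
    (e : A ≃ₜ* B) (S : Subgroup A) (S' : Subgroup B) (h : ∀ a, a ∈ S ↔ e a ∈ S') (P : A → Prop) (P' : B → Prop)
    (hP : ∀ a, P' (e a) → P a) (s' : Finset (Subgroup ↥S'))
    (hs' : ∀ K ∈ s', IsClosed (K : Set ↥S') ∧ ¬ IsOpen (K : Set ↥S')) (hcov' : ∀ t' : ↥S', ¬ P' (t' : B) → ∃ K ∈ s', t' ∈ K) :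
    ∃ s : Finset (Subgroup ↥S), (∀ K ∈ s, IsClosed (K : Set ↥S) ∧ ¬ IsOpen (K : Set ↥S)) ∧ ∀ t : ↥S, ¬ P (t : A) → ∃ K ∈ s, t ∈ K := by
  classical
  let eT : ↥S ≃ₜ* ↥S' := ContinuousMulEquiv.restrictSubgroup e S S' h
  refine ⟨s'.image fun K' => K'.comap eT.toMulEquiv.toMonoidHom, fun K hK => ?_, fun t ht => ?_⟩
  · obtain ⟨K', hK', rfl⟩ := Finset.mem_image.1 hK
    obtain ⟨hcl, hno⟩ := hs' K' hK'
    have hset : ((K'.comap eT.toMulEquiv.toMonoidHom : Subgroup ↥S) : Set ↥S) = eT ⁻¹' (K' : Set ↥S') := rfl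
    refine ⟨?_, fun hopen => hno ?_⟩
    · rw [hset]; exact hcl.preimage eT.continuous
    · rw [hset] at hopen
      have himg : (K' : Set ↥S') = eT.toHomeomorph '' (eT ⁻¹' (K' : Set ↥S')) := by
        rw [show (eT : ↥S → ↥S') = eT.toHomeomorph from rfl, Set.image_preimage_eq _ eT.toHomeomorph.surjective]
      rw [himg]
      exact eT.toHomeomorph.isOpenMap _ hopen
  · have ht' : ¬ P' ((eT t : ↥S') : B) := fun h' => ht (hP (t : A) h')
    obtain ⟨K', hK', htK'⟩ := hcov' (eT t) ht'
    exact ⟨K'.comap eT.toMulEquiv.toMonoidHom, Finset.mem_image.2 ⟨K', hK', rfl⟩, htK'⟩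

/-- **A property whose failure set lies in finitely many closed non-open subgroups holds Haar-a.e.** on a second-countable locally compact group (Steinhaus ★
`measure_subgroup_eq_zero_of_not_mem_nhds`; a subgroup that is a neighbourhood of `1` is open, Mathlib `Subgroup.isOpen_of_mem_nhds`; second countability makes every
Haar measure inner regular). [cite: HarishChandra1970, Lemma 42] [cite: Folland1995, Prop. 2.4] -/
theorem ae_of_finset_subgroup_cover {T : Type*} [Group T] [TopologicalSpace T] [IsTopologicalGroup T] [LocallyCompactSpace T]
    [SecondCountableTopology T] [MeasurableSpace T] [BorelSpace T] (μ : Measure T) [μ.IsHaarMeasure]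
    (s : Finset (Subgroup T)) (hs : ∀ K ∈ s, IsClosed (K : Set T) ∧ ¬ IsOpen (K : Set T)) {P : T → Prop}
    (hcov : ∀ t, ¬ P t → ∃ K ∈ s, t ∈ K) : ∀ᵐ t ∂μ, P t := by
  haveI : SigmaCompactSpace T := sigmaCompactSpace_of_locallyCompact_secondCountable
  haveI : RegularSpace T := IsTopologicalGroup.regularSpace _
  haveI : TopologicalSpace.PseudoMetrizableSpace T := inferInstance
  haveI : SigmaFinite μ := inferInstance
  haveI : μ.InnerRegular := Measure.instInnerRegularOfPseudoMetrizableSpaceOfSigmaCompactSpaceOfBorelSpaceOfSigmaFinite μ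
  have hnull : μ (⋃ K ∈ s, (K : Set T)) = 0 := by
    refine (measure_biUnion_null_iff s.countable_toSet).2 fun K hK => ?_
    obtain ⟨hcl, hno⟩ := hs K hK
    exact measure_subgroup_eq_zero_of_not_mem_nhds μ K hcl.measurableSet fun hmem => hno (K.isOpen_of_mem_nhds hmem)
  rw [ae_iff]
  refine measure_mono_null (fun t ht => ?_) hnull
  obtain ⟨K, hK, htK⟩ := hcov t ht
  exact Set.mem_biUnion hK htK

end Generic

section Nonsplit

variable {F E : Type} [Field F] [NumberField F] [Field E] [NumberField E] [Algebra F E] [Algebra.IsQuadraticExtension F E]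
  (c : E ≃ₐ[F] E) (N : ℕ) (J : Matrix (Fin N) (Fin N) E) {v : HeightOneSpectrum (𝓞 F)} (hc : c ≠ 1)
  (w : PlacesOver E v) (hw : c • w.1 = w.1)

/-! ## §1 The scalar inputs at `E_w`: a skew element and a `σ_w`-fixed null sequence -/

include hc in
/-- **A non-zero `σ_w`-skew scalar**: `δ = a − σ_w a ≠ 0` with `σ_w δ = −δ`, for any `a ∈ E` moved by `c` (`c ≠ 1`; `σ_w² = 1` on `E_w`, ★
`galAdicCompletionMap_galAdicCompletionMap_of_smul_eq`). [cite: PlatonovRapinchuk1994, §6.4] -/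
theorem exists_skew_ne_zero_adicCompletion :
    ∃ δ : w.1.adicCompletion E, galAdicCompletionMap (L := E) c hw δ = -δ ∧ δ ≠ 0 := by
  set σ := galAdicCompletionMap (L := E) c hw with hσdef
  have hσσ : ∀ x, σ (σ x) = x := fun x => galAdicCompletionMap_galAdicCompletionMap_of_smul_eq c w hc hw x
  -- an element of `E` moved by `c`
  obtain ⟨a, ha⟩ : ∃ a : E, c a ≠ a := by
    by_contra h
    push Not at h
    exact hc (AlgEquiv.ext h)
  refine ⟨(a : w.1.adicCompletion E) - σ (a : w.1.adicCompletion E), ?_, ?_⟩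
  · rw [map_sub, hσσ, neg_sub]
  · intro h0
    have h1 : σ (a : w.1.adicCompletion E) = (a : w.1.adicCompletion E) := (sub_eq_zero.1 h0).symm
    rw [hσdef, galAdicCompletionMap_coe] at h1
    exact ha ((algebraMap E (w.1.adicCompletion E)).injective h1)

include hc in
/-- **A `σ_w`-FIXED null sequence of non-zero scalars**: `ε_k = ϖ^k` with `ϖ = π · σ_w π`, `π ∈ E` a uniformiser at `w` (`0 < |ϖ|_w < 1`; Mathlib
`Valued.tendsto_zero_pow_of_v_lt_one`). [cite: PlatonovRapinchuk1994, §6.4] -/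
theorem exists_null_seq_fixed_adicCompletion :
    ∃ ε : ℕ → w.1.adicCompletion E, Tendsto ε atTop (𝓝 0) ∧ (∀ k, ε k ≠ 0) ∧ ∀ k, galAdicCompletionMap (L := E) c hw (ε k) = ε k := by
  set σ := galAdicCompletionMap (L := E) c hw with hσdef
  have hσσ : ∀ x, σ (σ x) = x := fun x => galAdicCompletionMap_galAdicCompletionMap_of_smul_eq c w hc hw x
  have hσv : ∀ x, Valued.v (σ x) = Valued.v x := fun x => valued_galAdicCompletionMap (L := E) c hw x
  obtain ⟨π₀, hπ₀⟩ := w.1.valuation_exists_uniformizer E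
  set ϖ : w.1.adicCompletion E := (π₀ : w.1.adicCompletion E) * σ (π₀ : w.1.adicCompletion E) with hϖdef
  have hπv : Valued.v (π₀ : w.1.adicCompletion E) = WithZero.exp (-1 : ℤ) := by
    rw [HeightOneSpectrum.valuedAdicCompletion_eq_valuation', hπ₀]
  have hπ1 : Valued.v (π₀ : w.1.adicCompletion E) < 1 := by
    rw [hπv, ← WithZero.exp_zero]; exact WithZero.exp_lt_exp.2 (by norm_num)
  have hπ0 : (π₀ : w.1.adicCompletion E) ≠ 0 := fun h => by
    rw [h, map_zero] at hπv; exact WithZero.coe_ne_zero hπv.symm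
  have hϖ1 : Valued.v ϖ < 1 := by
    rw [hϖdef, Valuation.map_mul, hσv]
    exact mul_lt_one_of_nonneg_of_lt_one_left zero_le hπ1 hπ1.le
  have hσϖ : σ ϖ = ϖ := by rw [hϖdef, map_mul, hσσ, mul_comm]
  have hϖ0 : ϖ ≠ 0 := by
    rw [hϖdef]
    refine mul_ne_zero hπ0 fun h => hπ0 ?_
    have := congrArg σ h; rwa [hσσ, map_zero] at this
  refine ⟨fun k => ϖ ^ k, Valued.tendsto_zero_pow_of_v_lt_one hϖ1, fun k => pow_ne_zero k hϖ0, fun k => ?_⟩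
  rw [map_pow, hσϖ]

/-! ## §2 The singular locus of `Z(γ)` lies in finitely many closed non-open subgroups -/

include hc w hw in
/-- **THE SINGULAR LOCUS OF A CARTAN SUBGROUP `T = Z(γ) ≤ U(J)(F_v)` (`γ` regular, `v` NON-SPLIT) LIES IN FINITELY MANY CLOSED, NON-OPEN SUBGROUPS OF `T`** (the
root kernels): ★ `exists_finset_subgroup_cover_singular_centralizer` in the one-place model `U(σ_w, J_w)(E_w)` (`E_w` a complete non-archimedean normed field of
characteristic `0`; the skew scalar and the `σ_w`-fixed null sequence of §1), transported along ★ `localNonsplitEquiv` restricted to the centralisers.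
[cite: HarishChandra1970, Lemma 42] [cite: Rogawski1990, §3.6 pp. 28–31] -/
theorem exists_finset_subgroup_cover_singular_centralizer_local (hJ : IsUnit J) (γ : «local» E c N J v)
    (hγ : IsRegularElt (γ : GL (Fin N) (LocalRing E v))) :
    ∃ s : Finset (Subgroup ↥(Subgroup.centralizer ({γ} : Set («local» E c N J v)))),
      (∀ K ∈ s, IsClosed (K : Set ↥(Subgroup.centralizer ({γ} : Set («local» E c N J v)))) ∧
        ¬ IsOpen (K : Set ↥(Subgroup.centralizer ({γ} : Set («local» E c N J v))))) ∧
      ∀ t : ↥(Subgroup.centralizer ({γ} : Set («local» E c N J v))),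
        ¬ IsRegularElt (((t : «local» E c N J v) : GL (Fin N) (LocalRing E v))) → ∃ K ∈ s, t ∈ K := by
  classical
  letI : NontriviallyNormedField (w.1.adicCompletion E) :=
    Valued.toNontriviallyNormedField (w.1.adicCompletion E) (WithZero (Multiplicative ℤ))
  haveI : CharZero (w.1.adicCompletion E) := charZero_of_injective_algebraMap (algebraMap E (w.1.adicCompletion E)).injective
  -- inputs of the generic theorem at `K = E_w`
  have h2 : (2 : w.1.adicCompletion E) ≠ 0 := two_ne_zero
  have hJw : IsUnit (placeForm J w.1).det := (Matrix.isUnit_iff_isUnit_det _).1 (isUnit_placeForm J hJ w.1)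
  obtain ⟨δ, hσδ, hδ⟩ := exists_skew_ne_zero_adicCompletion c hc w hw
  obtain ⟨ε, hε, hε0, hσε⟩ := exists_null_seq_fixed_adicCompletion c hc w hw
  -- the generic root-kernel cover in `U(σ_w, J_w)(E_w)`, read at a point `u` of the subtype group
  have key : ∀ u : ↥(unitaryGroupOfForm (galAdicCompletionMap (L := E) c hw) (placeForm J w.1)),
      ((u : GL (Fin N) (w.1.adicCompletion E)) : Matrix (Fin N) (Fin N) (w.1.adicCompletion E)).charpoly.Separable →
      ∃ s' : Finset (Subgroup ↥(Subgroup.centralizer ({u} : Set ↥(unitaryGroupOfForm (galAdicCompletionMap (L := E) c hw) (placeForm J w.1))))),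
        (∀ K ∈ s', IsClosed (K : Set ↥(Subgroup.centralizer ({u} : Set ↥(unitaryGroupOfForm (galAdicCompletionMap (L := E) c hw) (placeForm J w.1))))) ∧
          ¬ IsOpen (K : Set ↥(Subgroup.centralizer ({u} : Set ↥(unitaryGroupOfForm (galAdicCompletionMap (L := E) c hw) (placeForm J w.1)))))) ∧
        ∀ t' : ↥(Subgroup.centralizer ({u} : Set ↥(unitaryGroupOfForm (galAdicCompletionMap (L := E) c hw) (placeForm J w.1)))),
          ¬ ((((t' : ↥(unitaryGroupOfForm (galAdicCompletionMap (L := E) c hw) (placeForm J w.1))) :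
            GL (Fin N) (w.1.adicCompletion E)) : Matrix (Fin N) (Fin N) (w.1.adicCompletion E)).charpoly.Separable) → ∃ K ∈ s', t' ∈ K := by
    rintro ⟨u, huU⟩ hu
    exact exists_finset_subgroup_cover_singular_centralizer (galAdicCompletionMap (L := E) c hw) h2 hJw hσδ hδ hε hε0 hσε huU hu
  obtain ⟨s', hs', hcov'⟩ := key (localNonsplitEquiv c J hc w hw γ) (charpoly_separable_localNonsplitEquiv_of_isRegularElt c N J hc γ w hw hγ)
  -- transport along the one-place model restricted to the centralisers
  refine exists_finset_subgroup_cover_of_continuousMulEquiv (localNonsplitEquiv c J hc w hw) _ _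
    (fun a => (Literature.MeasureTheory.Group.mulEquiv_apply_mem_centralizer_singleton_iff (localNonsplitEquiv c J hc w hw).toMulEquiv γ a).symm)
    (fun a : «local» E c N J v => IsRegularElt (a : GL (Fin N) (LocalRing E v)))
    (fun b : ↥(unitaryGroupOfForm (galAdicCompletionMap (L := E) c hw) (placeForm J w.1)) =>
      ((b : GL (Fin N) (w.1.adicCompletion E)) : Matrix (Fin N) (Fin N) (w.1.adicCompletion E)).charpoly.Separable)
    (fun a ha => (isRegularElt_iff_charpoly_separable_localNonsplitEquiv c N J hc w hw a).2 ha) s' hs' hcov'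

/-! ## §3 Haar-almost every element of `Z(γ)` is regular -/

include hc w hw in
/-- **HAAR-ALMOST EVERY ELEMENT OF A CARTAN SUBGROUP `T = Z(γ) ≤ U(J)(F_v)` IS REGULAR** (`γ` regular semisimple, `v` non-split, `μ_T` ANY Haar measure on `T`): the
singular locus lies in finitely many closed non-open subgroups (§2), each Haar-null by Steinhaus (★ `measure_subgroup_eq_zero_of_not_mem_nhds`; `T` is closed in the
second-countable locally compact `U(J)(F_v)`, so `μ_T` is inner regular). [cite: HarishChandra1970, Lemma 42] [cite: Rogawski1990, §12.5 p. 184] [cite: Folland1995, Prop. 2.4] -/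
theorem ae_isRegularElt_centralizer_local (hJ : IsUnit J) (γ : «local» E c N J v)
    (hγ : IsRegularElt (γ : GL (Fin N) (LocalRing E v)))
    [MeasurableSpace («local» E c N J v)] [BorelSpace («local» E c N J v)]
    (μT : Measure ↥(Subgroup.centralizer ({γ} : Set («local» E c N J v)))) [μT.IsHaarMeasure] :
    ∀ᵐ t : ↥(Subgroup.centralizer ({γ} : Set («local» E c N J v))) ∂μT,
      IsRegularElt (((t : «local» E c N J v) : GL (Fin N) (LocalRing E v))) := by
  haveI : LocallyCompactSpace ↥(Subgroup.centralizer ({γ} : Set («local» E c N J v))) :=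
    (Set.isClosed_centralizer _).isClosedEmbedding_subtypeVal.locallyCompactSpace
  haveI : SecondCountableTopology ↥(Subgroup.centralizer ({γ} : Set («local» E c N J v))) :=
    TopologicalSpace.Subtype.secondCountableTopology _
  haveI : BorelSpace ↥(Subgroup.centralizer ({γ} : Set («local» E c N J v))) := Subtype.borelSpace _
  obtain ⟨s, hs, hcov⟩ := exists_finset_subgroup_cover_singular_centralizer_local c N J hc w hw hJ γ hγ
  exact ae_of_finset_subgroup_cover μT s hs hcov

end Nonsplit

end Literature.NumberTheory.Automorphic.UnitaryGroup

end
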